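import Summits.AnomalousDissipation.AnomalousDissipation.Theorems.QuarticGate.Negative.LevelOne

/-!
# Negative knowledge for the crux `MomentParity.QuarticGate` (stmt-AnomalousDissipation-11464),
# line `recession-cone`: the defect certificate (stub S3) NEEDS a Casimir-type hypothesis

(drefute seat, 2026-08-16.) Stub S3 `stub_defectCertificate` of the registered skeleton
`Cruxes/QuarticGate/Lines/recession-cone.lean` (landed as
`Theorems/MomentParityQuarticGateDefectCertificate.lean`) produces, from the sign lemma (S1) and
`NoCubicCasimir N`, a DEFECT CERTIFICATE for every level-`N` law with finite fourth moments:
finitely many level-`N` fields `v_l` and weights `c_l ≥ 0` with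
`row_μ(p₃) + Σ_l c_l {p₃, B_N}(v_l) = 0` for every homogeneous cubic band test `p₃`.

Hypothesis mutation (refuter's load-bearing analysis): delete the Casimir antecedent. The resulting
statement `DefectCertificateUnconditional` ("every level-`N` law with finite fourth moments has a
defect certificate, at every level, viscosity and smooth force") is FALSE, by the small model
`N = 1`: the unit ball carries no triad (`B_1 ≡ 0`, `LevelOne.lean`), so every Euler derivative
`{p₃, B_1}(v)` vanishes and a certificate exists iff ALL cubic rows of `μ` vanish — which fails for
the Dirac mass at the Kolmogorov state `[K_1]`, viscosity `1`, force `0`, and the cubic test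
`p₃(u) = (u, K_1)³`: its row is the Stokes term `∫⟪K_1, Δ(¾ K_1)⟫ = −3π²/2 ≠ 0`
(`not_hasDefectCertificate_dirac_kolState`, `not_defectCertificateUnconditional`).

Reading for the line: the Casimir antecedent of S3 can be WEAKENED (card `cubic-transversality`: by the
sign lemma alone `cone{ev_v} = L₃^⊥`, so it suffices that the cubic rows of `μ` vanish on the cubic
Casimirs `L₃`) but not DELETED; at a level with a nonzero cubic Casimir whose row does not vanish
no certificate exists, whatever the weights.
-/

namespace Summit.AnomalousDissipation.AnomalousDissipation.Theorems.QuarticGate.Negative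

open MeasureTheory Filter Topology
open scoped ENNReal InnerProductSpace RealInnerProductSpace
open Literature.Analysis.FunctionSpaces Literature.Analysis.FluidPDE
open Summit.AnomalousDissipation.AnomalousDissipation.Theses.MomentParity

-- `Summit.<Summit>.<Problem>` is the tree's mandated summit-side namespace (CONVENTIONS §2); for this
-- single-conjunct summit the two coincide, so the duplicate is deliberate.
set_option linter.dupNamespace false

noncomputable section

/-- The CONCLUSION of stub S3 `stub_defectCertificate` (verbatim, through the `LevelCeiling`
vocabulary): `μ` admits a defect certificate at `(ν, f, N)` — finitely many level-`N` fields `v_l`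
and weights `c_l ≥ 0` such that `row_μ(p₃) + Σ_l c_l {p₃, B_N}(v_l) = 0` for every homogeneous cubic
band test `p₃`. -/
def HasDefectCertificate (ν : ℝ) (f : UnitAddTorus (Fin 3) → EuclideanSpace ℝ (Fin 3)) (N : ℕ)
    (μ : Measure (Torus.energySpace (Fin 3))) : Prop :=
  ∃ (M : ℕ) (v : Fin M → Torus.energySpace (Fin 3)) (c : Fin M → ℝ),
    (∀ l, IsLevel N (v l)) ∧ (∀ l, 0 ≤ c l) ∧
    ∀ (m : ℕ) (g : Fin m → UnitAddTorus (Fin 3) → EuclideanSpace ℝ (Fin 3))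
      (P : MvPolynomial (Fin m) ℝ), (∀ i, IsBandTest N (g i)) → P.IsHomogeneous 3 →
      ∫ u, Torus.nsGeneratorPairing ν f u (polyGrad g P u) ∂μ +
        ∑ l, c l * Torus.nsGeneratorPairing (d := Fin 3) 0 0 (v l) (polyGrad g P (v l)) = 0

/-- MUTATED S3: the defect certificate claimed UNCONDITIONALLY (both antecedents of
`stub_defectCertificate` — the sign lemma, which is a theorem, and `NoCubicCasimir N` — deleted):
every level-`N` probability law with finite fourth moments has a defect certificate, at every level
`N`, every viscosity `ν` and every smooth force `f`. FALSE: `not_defectCertificateUnconditional`. -/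
def DefectCertificateUnconditional : Prop :=
  ∀ (N : ℕ) (ν : ℝ) (f : UnitAddTorus (Fin 3) → EuclideanSpace ℝ (Fin 3)), Torus.IsSmooth f →
    ∀ μ : Measure (Torus.energySpace (Fin 3)), IsProbabilityMeasure μ →
      (∀ᵐ u ∂μ, IsLevel N u) → Integrable (fun u : Torus.energySpace (Fin 3) => ‖u‖ ^ 4) μ →
      HasDefectCertificate ν f N μ

/-- The differential field of the cubic observable `p₃(u) = (u, K_1)³` at the Kolmogorov state
`[K_1]`: `∇p₃([K_1]) = 3 (K_1, K_1)² K_1 = ¾ K_1 = K_{3/4}`. [folklore] -/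
theorem polyGrad_X_pow_three_kolState :
    polyGrad (fun _ : Fin 1 => kolField 1) (MvPolynomial.X 0 ^ 3) (kolState 1) = kolField (3 / 4 * 1) := by
  funext x
  rw [kolField_mul]
  simp only [polyGrad, Finset.univ_unique, Fin.default_eq_zero, Finset.sum_singleton,
    Derivation.leibniz_pow, MvPolynomial.pderiv_X_self, smul_eq_mul, mul_one,
    pairing_kolState_kolField, nsmul_eq_mul, Nat.cast_ofNat]
  norm_num

/-- The Galerkin row at the Kolmogorov state `[K_1]` with ZERO force against the band test `K_b`:
only the Stokes term survives, `⟨F([K_1]), K_b⟩ = ν ∫⟪K_1, ΔK_b⟫ = −2π²νb` (the inertial term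
vanishes at level one, `B_1 ≡ 0`). [folklore] -/
theorem nsGeneratorPairing_zero_force_kolState (ν b : ℝ) :
    Torus.nsGeneratorPairing ν 0 (kolState 1) (kolField b) = -(2 * Real.pi ^ 2 * ν * b) := by
  have hin : Torus.inertialPairing ((kolState 1).1 : Lp (EuclideanSpace ℝ (Fin 3)) 2 (volume : Measure (UnitAddTorus (Fin 3)))) (kolField b) = 0 := by
    have h := nsGeneratorPairing_zero_zero_of_level_one (kolState 1) (isLevel_kolState 1 le_rfl)
      (isSmooth_kolField b) (fun k hk => tcoef_kolField_eq_zero b hk)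
    unfold Torus.nsGeneratorPairing at h
    simpa using h
  have hlap : ∫ x, ⟪(((kolState 1).1 : Lp (EuclideanSpace ℝ (Fin 3)) 2 (volume : Measure (UnitAddTorus (Fin 3)))) : UnitAddTorus (Fin 3) → EuclideanSpace ℝ (Fin 3)) x,
      Torus.laplacian (kolField b) x⟫_ℝ = -(4 * Real.pi ^ 2) * b * (1 ^ 2 / 2) := by
    rw [← integral_norm_sq_kolField 1, ← integral_const_mul]
    refine integral_congr_ae ((coe_kolState_ae 1).mono fun x hx => ?_)
    simp only at hx ⊢
    rw [hx, laplacian_kolField, show kolField b x = kolField (b * 1) x by rw [mul_one], kolField_mul,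
      real_inner_smul_right, real_inner_smul_right, real_inner_self_eq_norm_sq]
    ring
  unfold Torus.nsGeneratorPairing
  rw [hin, hlap]
  simp only [Pi.zero_apply, inner_zero_left, integral_zero, zero_add, add_zero]
  ring

/-- **No defect certificate for `δ_{[K_1]}` at level one, viscosity `1`, force `0`.** Every Euler
derivative at a level-`1` field vanishes (`B_1 ≡ 0`), so a certificate would force the cubic row of
`p₃(u) = (u, K_1)³` to vanish; it equals `−3π²/2`. [folklore] -/
theorem not_hasDefectCertificate_dirac_kolState :
    ¬ HasDefectCertificate 1 0 1 (Measure.dirac (kolState 1)) := by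
  haveI : MeasurableSingletonClass (Torus.energySpace (Fin 3)) :=
    OpensMeasurableSpace.toMeasurableSingletonClass
  rintro ⟨M, v, c, hv, -, hcert⟩
  have h := hcert 1 (fun _ => kolField 1) (MvPolynomial.X 0 ^ 3) (fun _ => isBandTest_kolField 1)
    ((MvPolynomial.isHomogeneous_X ℝ (0 : Fin 1)).pow 3)
  have hz : ∀ l, Torus.nsGeneratorPairing (d := Fin 3) 0 0 (v l)
      (polyGrad (fun _ : Fin 1 => kolField 1) (MvPolynomial.X 0 ^ 3) (v l)) = 0 := fun l =>
    euler_bracket_polyGrad_eq_zero_of_level_one _ _ (fun _ => isBandTest_kolField 1) (v l) (hv l)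
  simp only [hz, mul_zero, Finset.sum_const_zero, add_zero] at h
  rw [integral_dirac, polyGrad_X_pow_three_kolState, nsGeneratorPairing_zero_force_kolState] at h
  have hpi : 0 < Real.pi := Real.pi_pos
  nlinarith [h, hpi]

/-- **The Casimir antecedent of S3 is load-bearing**: the unconditional defect-certificate statement
is false (witness: `N = 1`, `ν = 1`, `f = 0`, `μ = δ_{[K_1]}`, which is a level-`1` probability law
with finite fourth moments). [folklore] -/
theorem not_defectCertificateUnconditional : ¬ DefectCertificateUnconditional := by
  haveI : MeasurableSingletonClass (Torus.energySpace (Fin 3)) :=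
    OpensMeasurableSpace.toMeasurableSingletonClass
  intro h
  refine not_hasDefectCertificate_dirac_kolState (h 1 1 0 ?_ (Measure.dirac (kolState 1)) inferInstance ?_
    (Torus.integrable_dirac _ _))
  · exact Torus.isSmooth_const (0 : EuclideanSpace ℝ (Fin 3))
  · rw [ae_dirac_eq]; simpa using isLevel_kolState 1 le_rfl

end

end Summit.AnomalousDissipation.AnomalousDissipation.Theorems.QuarticGate.Negative
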